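import Mathlib
import HarnessLib
import HarnessLib.Audit
import Summits.Langlands.Statement
import HarnessLib.Audit.Status.Attr

/-!
Route: EisensteinMonodromy

# Route EisensteinMonodromy — Monodromy at v∤p for non-polarizable GL_n over CM fields via the
Eisenstein envelope

It suffices to show X = GenericMonodromy: for every CM field K, every regular algebraic cuspidal π
on GL_n(𝔸_K), every prime p,
ι : ℚ̄_p ≃ ℂ and every SEMISIMPLE ρ : Γ_K → GL_n(ℚ̄_p) whose arithmetic-Frobenius characteristic
polynomials are the ones
predicted by the Satake parameters of π at all but finitely many places (`∀ᶠ v in cofinite`,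
C-normalisation `arithFrobPolyOfSatake ι q_v n α`
— by Chebotarev + Brauer–Nesbitt, in tree as
`FramedGaloisRep.nonempty_equiv_of_hasFrobCharpolyAt_eventually`, this says ρ ≅ r_{p,ι}(π)
of HarrisLanTaylorThorneRMS2016 Thm A whenever the latter exists; rev 2 states it WITHOUT
`HarrisLanTaylorThorne2016.IsCompatible` so that
the route file imports nothing beyond the Statement), the Weil–Deligne representation of
ρ|Γ_{K_v} (Grothendieck–Deligne recipe `IsWeilDeligneOfLadic`) at every finite v ∤ p is GENERIC in
the sense of Allen2016 §1.1: it
admits no non-zero Weil–Deligne map to its own ‖·‖-twist. Given Varma's semisimple compatibility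
(VarmaFMS2024 Thm 1) and the
uniqueness of the generic Frobenius-semisimple WD representation with prescribed traces (support
item GenericWDUnique), X is exactly
"ι WD(r_{p,ι}(π)|_{K_v})^{F-ss} ≅ rec(π_v |det|^{(1-n)/2}) at every v ∤ p" — the v ∤ ℓ clause of
`LocalGlobalCompatibleAt` in direction
(A) of `Langlands` for the CM / regular sector (C-normalisation), and precisely hypothesis (e) of
Acampo2023 Thm 1.0.1 turned into a
theorem. Realises card eisenstein-degeneration-monodromy; the route's own mechanism statement is the
rank-2 crux
EisensteinEnvelopeGeneric (the 2n-dimensional Siegel–Eisenstein object), which implies X by the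
in-tree twisted-sum decomposition.
Lean: `∀ (K : Type) [Field K] [NumberField K], NumberField.IsCMField K → ∀ (n : ℕ) (hcpt :
Literature.NumberTheory.Automorphic.isCompact_glFiniteIntegralLevel n K) (π :
Literature.NumberTheory.Automorphic.CuspidalAutomorphicRepData n K hcpt), π.1.IsRegularAlgebraic → ∀
(p : ℕ) [Fact p.Prime] (ι : PadicAlgCl p ≃+* ℂ) (ρ :
Literature.NumberTheory.GaloisRepresentations.FramedGaloisRep K (PadicAlgCl p) n),
ρ.toGaloisRep.IsSemisimple → (∀ᶠ v : IsDedekindDomain.HeightOneSpectrum (NumberField.RingOfIntegers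
K) in Filter.cofinite, ∀ α : Multiset ℂ, π.1.HasSatakeParamAt v α → ρ.IsUnramifiedAt v ∧
ρ.HasFrobCharpolyAt v (Literature.NumberTheory.Automorphic.arithFrobPolyOfSatake ι v.residueCard n
α)) → ∀ v : IsDedekindDomain.HeightOneSpectrum (NumberField.RingOfIntegers K), ((p : ℕ) :
NumberField.RingOfIntegers K) ∉ v.asIdeal → ∃ W :
Literature.NumberTheory.GaloisRepresentations.WeilDeligneRep (v.adicCompletion K) (PadicAlgCl p)
(Fin n → PadicAlgCl p), Literature.NumberTheory.GaloisRepresentations.IsWeilDeligneOfLadic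
(ρ.toLocal v).toWeilGroupHom W ∧ ∀ f : (Fin n → PadicAlgCl p) →ₗ[PadicAlgCl p] (Fin n → PadicAlgCl
p), (∀ w : Literature.NumberTheory.GaloisRepresentations.WeilGroup (v.adicCompletion K), f ∘ₗ W.ρ w
= ((Literature.NumberTheory.GaloisRepresentations.IsNonarchimedeanLocalField.residueFieldCard
(v.adicCompletion K) : PadicAlgCl p) ^ (Literature.NumberTheory.GaloisRepresentations.WeilGroup.deg
w)) • (W.ρ w ∘ₗ f)) → f ∘ₗ W.N = W.N ∘ₗ f → f = 0`

## Assembly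
EisensteinEnvelopeGeneric gives X (support EnvelopeToTarget, typed and provable now), and the
declared, NOT-claimed out-of-scope
remainder MonodromyToLanglands : X → Langlands (support, rev 2) — everything in the summit beyond
the v ∤ ℓ monodromy clause for
regular π over CM fields (the reciprocity data 𝓡, direction (B), irregular π, non-CM F, v ∣ ℓ,
irreducibility / de Rham, the L- vs
C-normalisation twist, Varma's semisimple part and GenericWDUnique to reach `rec`) — carries X to
the summit constant. Deciding
theorem (D-0027 §2.1): `closes : GenericMonodromy → EisensteinEnvelopeGeneric →
RankTwoGenericMonodromy → GenericWDUnique →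
EnvelopeToTarget → MonodromyToLanglands → Assembly → Langlands := hL (hET hE)`; the item Assembly is
the same chain as a Prop
(`EisensteinEnvelopeGeneric → EnvelopeToTarget → MonodromyToLanglands → Langlands`, provable
outright). MonodromyToLanglands is not
a claim of this route and is not to be staffed from it (same pattern as
DegenerateLimits.LanglandsOfTarget,
TriangulineChamber.SliceToLanglands, CapacityClassicality.SectorToLanglands).

Rationale: WHY THIS LINE. The only Galois representations of a non-polarizable π that live near Shimura
cohomology are HLTT's semisimple 2n-dimensional
R_{p,ı}(π,N) ≅ r_{p,ı}(π) ⊕ r_{p,ı}(π)^{c,∨} ε_p^{1-2n-2N} (HarrisLanTaylorThorneRMS2016 Cor. 6.27;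
in tree as the named fact
corollary627_splitOrUnramified), p-adic limits of Galois representations of cusp forms on U(n,n);
ℓ-adic interpolation tracks
characteristic polynomials and, via Bernstein-centre idempotents, semisimple L-parameters and a
BOUND N_Gal ≼ N_aut (VarmaFMS2024 §9,
Prop. 9.1, Def. of ≺), but "it doesn't seem possible to understand the monodromy operator in this
way" (AllenNewton2020 p. 1). The bet
imported from the representation theory of p-adic groups in families (EmertonHelm2014: co-Whittaker
A[GL_m(K_v)]-modules and the
strong local–global compatibility conjecture in families; HelmMoss2018: existence/uniqueness of the
universal co-Whittaker family over
the integral Bernstein centre) is that the Hecke module of the U(n,n) ordinary family LOCALISED AT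
THE SIEGEL–EISENSTEIN EIGENSYSTEM
x_E is co-Whittaker, so that its specialisation at x_E is the GENERIC representation with the
interpolated supercuspidal support — an
identity at the special fibre replacing the wrong-way semicontinuity of rank N. Two observations
make the Galois side clean: (i) in
HLTT's family the second block is twisted by ε_p^{-2N}, N ≫ 0, so the two blocks of
R_{p,ı}(π,N)|_{W_v} are separated by weight q_v^{2n-1+2N}
and the card's "phase-genericity" hypothesis is automatic (no self-congruence places; the
weight-adjacent Scholze/ACC+ boundary is
deliberately NOT the host); (ii) genericity passes from a WD representation to its direct summands
for free, and R_N splits off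
r_{p,ı}(π) by HLTT Prop. 7.12 (in tree, PROVED: prop712Hausdorff_holds), so the whole Galois-side
glue is typed and provable now
(support EnvelopeToTarget). Calibration: n = 2, weight 0 is AllenNewton2020 (density-one set of p,
by Luu's level trick +
potential automorphy + ACC+ lifting — a different mechanism) and Matsumoto arXiv:2312.01551 (found
by the route review): Thm 1.5 n = 2,
EVERY cohomological weight, positive-density sets of ℓ; Thm 1.1 all n, ℓ > n², ι-ordinary π under
generic residual conditions; Thm 1.3
all n on positive-density ℓ under self-twist / weight-gap hypotheses (potential automorphy + Varma ≺
+ a parahoric criterion, again a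
different mechanism) — so X is KNOWN on large sectors and the route's residual content is "every ℓ /
non-ordinary / small ℓ";
n ≤ 4 totally real: irreducibility of r_ι(π) (arXiv:2603.19768, Böckle–Hui) closes the gap between X
(semisimple ρ) and the bare ∃ρ
clause. No prior route exists on this summit; negatives index empty at filing.

RANKED CRUXES. #0 GenericMonodromy (target) — X above — every semisimple ρ with the Satake-predicted
Frobenius characteristic polynomials at cofinitely many places (rev 2: replaces
`HarrisLanTaylorThorne2016.IsCompatible`; formally the wider class of ρ, the same class by
Chebotarev + Brauer–Nesbitt once r_{p,ι}(π) exists) of a regular algebraic cuspidal π over a CM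
field has generic Weil–Deligne representation at every finite v ∤ p (all n, all p). (why it might
fail: N can drop in p-adic limits of traces (nothing in ℓ-adic interpolation forces it up,
AllenNewton2020 p.1); and if r_ι(π) is reducible with inter-constituent extension monodromy the
SEMISIMPLE ρ has N too small while (A) survives with a non-semisimple ρ.) [VarmaFMS2024,
AllenNewton2020, Acampo2023, HarrisLanTaylorThorneRMS2016, arXiv:2603.19768]
#2 EisensteinEnvelopeGeneric (crux) — (card items C1+C2 pushed to the Galois side; Varma's Prop. 9.1
with ≺ upgraded to equality) for K CM, π regular algebraic cuspidal on GL_n(𝔸_K), p, ι: there are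
N₀, semisimple R_N : Γ_K → GL_2n(ℚ̄_p) (N ≥ N₀) and n-element multisets B_v ⊂ ℚ̄_p^× with the HLTT
Cor. 6.27 characteristic polynomials arithFrobPolyOfSatake ι q_v n α · ∏_(b∈B_v)(X − b q_v^(−2N)) at
all but finitely many v, such that for every v ∤ p and all N ≫_v 0 the Weil–Deligne representation
of R_N|Γ_(K_v) is GENERIC. [difficulty: open-problem] Caveat recorded by route review #3 (S1): B_v
is unconstrained, so modulo HLTT Thm A existence this typed statement is EQUIVALENT to X (R_N := r ⊕
(ε_p^(−2N))^n, B_v = {1,…,1}); the mechanism proper lives in the informal cruxes #3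
BoundaryCoWhittaker / #4 GenericFibreInducedType until CoWhittakerModule is defined, and a tenure
pass should either tie R_N to HLTT's Π(N) or re-badge this item. (why it might fail: The
Eisenstein-localised Hecke module of the U(n,n) ordinary family may fail to be co-Whittaker at v
(parabolically induced v-component; boundary/torsion contributions), in which case N of R_N is
strictly dominated (Varma's ≺ strict) although r_ι(π) itself could still be fine.)
[HarrisLanTaylorThorneRMS2016, VarmaFMS2024, EmertonHelm2014, HelmMoss2018, Caraiani2012,
AllenNewton2020]
#5 RankTwoGenericMonodromy (crux) — the n = 2 case of X for ALL regular weights and ALL primes p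
(calibration rung; literally the n = 2 instance of #0, `rankTwo_of_generic`, so a proof of #0 closes
it in one line; as a stand-alone statement the mechanism must reprove and extend AllenNewton2020 —
weight 0, Dirichlet-density-one p — and Matsumoto arXiv:2312.01551 Thm 1.5 — every cohomological
weight, positive-density ℓ). [difficulty: L] (why it might fail: Lifting methods give n = 2 only for
density-one / positive-density sets of p (AllenNewton2020 Thm 1.1, wt 0; arXiv:2312.01551 Thm 1.5,
all wts): ALL p is open; for p = 2, p | disc K, non-ordinary π_p the U(2,2) family and co-Whittaker
property are untested; reducible r_ι(π) breaks semisimple form.) [AllenNewton2020, arXiv:2312.01551,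
VarmaFMS2024, HarrisLanTaylorThorneRMS2016, AllenCalegariCaraianiGeeEtAl2023]
#9 GenericWDUnique (support) — over an algebraically closed field of characteristic 0, two
Frobenius-semisimple GENERIC Weil–Deligne representations of W_F on the same space with equal traces
of ρ(w) for all w are isomorphic (ρ ≅ ρ' by Brauer–Nesbitt + "Φ-semisimple ⇒ semisimple"; generic ⇔
N in the open orbit of the centraliser on {N}; the open orbit is unique). This is the lemma turning
X + Varma's semisimple compatibility into the summit's v ∤ ℓ clause; pure algebra, provable now.
[difficulty: provable-now] [Allen2016, VarmaFMS2024, TateCorvallis1979, BellaicheChenevier2009]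
#9 EnvelopeToTarget (support) — glue EisensteinEnvelopeGeneric → GenericMonodromy: for N in the
infinite set where R_N is semisimple with the Cor. 6.27 polynomials, HLTT Prop. 7.12 (in tree,
proved:
Literature.NumberTheory.GaloisRepresentations.HarrisLanTaylorThorne2016.prop712Hausdorff_holds, with
hasSatakeParamAt_ne_zero_holds, frobenius_dense, chebotarev_artinRep_holds, the μ = ε_p^(−2)
realisation of HarrisLanTaylorThorneThm713) gives semisimple A, C with R_N ≅ A ⊕ C⊗ε^(−2N) and A
HLTT-compatible; any semisimple ρ with the Satake-predicted characteristic polynomials cofinitely is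
≅ A (FramedGaloisRep.nonempty_equiv_of_hasFrobCharpolyAt_eventually with chebotarev_artinRep_holds —
rev 2; theoremA_uniqueness_holds no longer needed); the Grothendieck–Deligne recipe is
conjugation-equivariant and block-diagonal for a block-diagonal representation (same t, U, Φ; t(u) ≠
0 pins N blockwise), and a generic WD representation has generic direct summands (extend f by 0).
Provable now. [difficulty: M] [HarrisLanTaylorThorneRMS2016, VarmaFMS2024]
#9 MonodromyToLanglands (support, rev 2) — OUT-OF-SCOPE REMAINDER `GenericMonodromy → Langlands`,
declared and NOT claimed, filed only so that the deciding theorem `closes` ends at the summit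
constant (D-0027 §2.1): the reciprocity data 𝓡 for every number field, direction (B), direction (A)
outside the CM/regular/v ∤ ℓ monodromy clause, and the translation of X into
`LocalGlobalCompatibleAt` (VarmaFMS2024 Thm 1 in WD vocabulary + GenericWDUnique + "rec of generic
is generic" + the |det|^((1−n)/2) twist). Not to be staffed from this route; dischargeable only as
the conjunction of other routes. [BuzzardGeeLMS2014, VarmaFMS2024]
#1 Assembly (assembly, rev 2) — `EisensteinEnvelopeGeneric → EnvelopeToTarget → MonodromyToLanglands
→ Langlands`, pure bookkeeping (fun hE hET hL => hL (hET hE)); the deciding theorem `closes` (all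
seven typed items → Langlands := hL (hET hE)) is what certifies the route.

TWO-LAYER PLAN. Foreseen glued split of EisensteinEnvelopeGeneric once the informal mechanism cruxes
are typed (definition requests CoWhittakerModule,
WeilDeligneRep.IsGeneric): EisensteinEnvelopeGeneric ⇐ BoundaryCoWhittaker (the
𝕋_(x_E)[GL_2n(K_v)]-module of HLTT's ordinary U(n,n)
family localised at the Siegel–Eisenstein eigensystem is co-Whittaker for the universal pair
(R_A|W_v, N_A): EmertonHelm2014 Conj. 1.1.3
shape at an Eisenstein point) → GenericFibreInducedType (Zariski-dense classical cuspidal points of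
the component through x_E have
monodromy of the induced type, by Caraiani2012 purity at those points + local constancy of inertial
types) → EisensteinEnvelopeGeneric
(glue: co-Whittaker specialisation at x_E is the generic representation with supercuspidal support
rec⁻¹(R_N|W_v^ss), whose parameter
is generic; Helm–Moss interpolation identifies it with WD(R_N)). Both children are filed NOW as
informal crux items (ranks 3, 4). A base-
change support item (HLTT setting K ⊇ F₀ imaginary quadratic with p split → general CM K, v
arbitrary: choose F₀ with v split) is
foreseen but routine (ArthurClozel1989) and not filed.

KILL CRITERIA. EisensteinEnvelopeGeneric refuted at an instance with r_ι(π) irreducible refutes X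
and the summit's clause itself (spectacular; record
and close refuted:EisensteinEnvelopeGeneric). A refutation exploiting a REDUCIBLE r_ι(π) kills only
the semisimple form: pivot by
restating X/Envelope for a Bellaïche–Chenevier lattice (BellaicheChenevier2009 §1.5) instead of the
semisimplification. If
BoundaryCoWhittaker is shown false for some Bernstein component (non-generic cosocle of the
Eisenstein specialisation, e.g. for
supercuspidal π_v × π_cv-type inductions), restate with the "co-Jacquet"/top-derivative variant or
restrict to components where the
induced representation is irreducible; if it fails for all components, close exhausted.
RankTwoGenericMonodromy proved by lifting
methods for all p (extension of AllenNewton2020) does not moot the route but removes its calibration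
value; X proved elsewhere (e.g. via
card conjugate-dual-purification) ⇒ close superseded.

NOT DECOMPOSED YET. The automorphic side is entirely informal at open (no Hecke algebras, ordinary
U(n,n) families, Bernstein centre or co-Whittaker
modules in the tree): BoundaryCoWhittaker and GenericFibreInducedType are filed as informal cruxes
with definition requests, not
typed; the solvable/quadratic base change from HLTT's standing hypotheses (F₀ ⊆ K, p split) to
general CM K; the translation of X into
the literal `LocalGlobalCompatibleAt` clause (needs Varma's Thm 1 as a Literature fact in WD
vocabulary — cite item filed — plus
GenericWDUnique and "rec of a generic π_v is generic", Allen2016 §1.1); torsion/Scholze-boundary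
variants (Hevesi-type semisimple
torsion compatibility) are other cards' business. Rev 2 (route-repair g4): the summit
complement is now the explicit support item MonodromyToLanglands instead of an inline hypothesis of
Assembly; the two Literature
imports (ReciprocityGLnProofs, TwistedSumDecomposition) are dropped — their unproved named facts
theoremA_existence,
corollary93_unramified (XL) and prop712 (REFUTED in tree, not_prop712) were never load-bearing: X is
stated by cofinite Frobenius
charpolys, and the PROVED prop712Hausdorff_holds / theoremA_uniqueness_holds are imported by the
prover's Theorems file, not by the
route. needs-fact: none beyond the Statement's own cone (shared by every Langlands route).

CHEAPEST FALSIFIER. (1) Already run here (by hand): in HLTT's normalisation the two blocks of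
R_(p,ı)(π,N)|W_v differ by the weight shift q_v^(2n−1+2N), larger
than any segment interaction (≤ q_v^(n−1)), so they are never linked — the card's fastest refutation
(i) ("phases forced equal") does
not arise in this host; it would in the weight-adjacent Borel–Serre boundary. (2) The decisive cheap
test for refuters: take n = 2, K
imaginary quadratic (= F₀), π of weight 0 Steinberg at v, and check in EmertonHelm2014 §6 / Helm's
criterion whether the x_E-localised
ordinary H⁰ of HLTT §6 can be co-Whittaker at v: its fibre at x_E must have cosocle St·|·|^a ×
(St·|·|^b) (irreducible, generic since
unlinked) and top derivative free of rank one over the local ring at x_E; a torsion top derivative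
there kills BoundaryCoWhittaker.
(3) Lookup: any p for which r_(p,ι)(π) of a weight-0 Steinberg-at-v π over a CM field is PROVED
unramified at v would refute
RankTwoGenericMonodromy — none is known (AllenNewton2020 proves the opposite for density-one p).

NUMBERS. Weight separation between the blocks: q_v^(2n−1+2N) (HarrisLanTaylorThorneRMS2016 Cor.
6.27: ε_p^(1−2n−2N)); N ≥ N₀(π) "sufficiently
large". AllenNewton2020 Thm 1.1: n = 2, weight 0, Dirichlet density ONE set of ℓ, all v ∤ ℓ.
VarmaFMS2024 Thm 1–2: semisimple parts equal
and N_Gal ≼ N_aut at EVERY v ∤ ℓ, all n. Irreducibility of r_ι(π) (gap X vs ∃ρ): n ≤ 4 over totally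
real fields (arXiv:2603.19768 Thm A,
Böckle–Hui n = 3). Matsumoto arXiv:2312.01551: Thm 1.1 all n, ℓ > n², ι-ordinary; Thms 1.3 / 1.5
positive-density sets of ℓ (1.5: n = 2, every
cohomological weight). Items (rev 2): 7 typed (target, 2 cruxes, 3 support incl.
MonodromyToLanglands, assembly) + 2 informal cruxes = 9 (≤ 15).

DEFINITION REQUESTS. (d1) `WeilDeligneRep.IsGeneric`
(Literature/NumberTheory/GaloisRepresentations): Allen2016 Def. 1.1.2, Hom_WD((ρ,N),(ρ⊗‖·‖,N)) = 0,
with the lemmas "generic ⇔ open orbit" and "stable under direct summands"; it would shorten every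
statement of this route. (d2)
`CoWhittakerModule` (Literature/NumberTheory/Automorphic): EmertonHelm2014 Def. 6.1–6.2 /
HelmMoss2018 §2 (admissible A[GL_m(F)]-module,
top derivative free of rank one, no quotient with vanishing top derivative; universal co-Whittaker
module over the integral Bernstein
centre) — needed to type BoundaryCoWhittaker. Cite fact wanted: VarmaFMS2024 Thm 2 / Def. 8.2 (≺:
equal W-semisimplification and
dominated monodromy partitions) in the tree's WeilDeligneRep vocabulary.

Novelty: Searches (2026-08-15): `lit search --source zbmath "local-global compatibility regular algebraic
cuspidal CM field monodromy"` (4: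
Caraiani2014 ℓ=p, AllenNewton2020, VarmaFMS2024, Sorensen2010); `--source crossref … 2021+` (15;
relevant: Acampo2023, Yang 2023 MRL
ordinary rank-2 ℓ=p); `--source zbmath "A'Campo rigidity"` (1); `lit frontier Langlands --since
2022` (30; relevant arXiv:2603.19768 —
irreducibility + Zariski-closure "monodromy groups" of GL(4), NOT local N; arXiv:2605.03519
infinitesimal characters of completed
cohomology); `lit galaxy search "local Langlands correspondence in families" --star all` (1:
arXiv:2403.19565 JNWE categorical p-adic LLC
for GL₂(ℚ_p)); `lit galaxy search "co-Whittaker" --star pdf` (0); reads: AllenNewton2020 pp.1–2,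
VarmaFMS2024 §9 p.19, Acampo2023 p.3,
arXiv:2603.19768 pp.1–3; plus the card audit's own searches (EmertonHelm/JNS/Disegni/Hevesi).
Nearest prior art found: Matsumoto arXiv:2312.01551 v3 (added rev 2 after the route review, zbMATH;
pp. 1–5, 17 read by refuter
b4055acd): monodromy local–global compatibility at v ∤ ℓ over CM fields PROVED for all n when ℓ > n²
and π is ι-ordinary with generic
residual conditions (Thm 1.1), for all n on positive-density sets of ℓ under self-twist / weight-gap
hypotheses (Thm 1.3), and for n = 2,
every cohomological weight, positive-density ℓ (Thm 1.5) — by potential automorphy + Varma's ≺ + a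
parahoric criterion (Prop. 2.20), a
different mechanism; VarmaFMS2024 (same object R_(p,ı)(π,N), Bernstei  [refs: 2603.19768, 2605.03519, 2403.19565, 2312.01551, Caraiani2014, AllenNewton2020, VarmaFMS2024, Acampo2023, EmertonHelm2014, HelmMoss2018]

Barriers (technique_class: llc-in-families, eisenstein-congruences, eigenvariety): - technique_class: llc-in-families, eisenstein-congruences, eigenvariety
- Literature.Barriers.Langlands.ShimuraVarietyRealizationBarrier: not evaded and not engaged beyond
its scope — K is CM throughout (U(n,n) over K⁺ exists); the non-polarizable π enters only through
the Eisenstein point of a polarizable family, exactly the HLTT/Scholze evasion the barrier records;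
nothing is claimed for F neither CM nor totally real.
- Literature.Barriers.Langlands.NonRegularWeightBarrier: not evaded — π is regular algebraic in
every item (hypothesis `IsRegularAlgebraic`); the ordinary/eigenvariety family is through
cohomological points only.
- Literature.Barriers.Langlands.TwistedEndoscopySelfDual: evaded in the HLTT manner — all
trace-formula/Shimura input is consumed at θ-stable (polarized) cuspidal points of U(n,n); the
non-θ-stable π is reached by p-adic degeneration to the Eisenstein point, not by comparison of trace
formulae.
- Literature.Barriers.Langlands.TaylorWilesNumericalCoincidence /
TaylorWilesNumericalCoincidenceNarrow / PatchingLocalComponentBarrier / ResiduallyReducibleBarrier: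
not engaged — no automorphy lifting or patching is run (direction (A) only); the
residually-reducible flavour of the Eisenstein point is handled by lattice choice on the Galois side
(semisimple R_N, BellaicheChenevier2009), not by Taylor–Wiles systems.
- Literature.Barriers.Langlands.ModPLanglandsGL2BeyondQp, ShtukaConstantFieldBarrier,
SolvableImageBarrier: not in the technique class (no p-adic l

Novelty grade: new-combination — REGRADE 12:18Z (supersedes my 12:11Z note; same grade, corrected prior art). ROUTE REVIEW refuter b4055acd (record: evidence REVIEW_EisensteinMonodromy.md incl. §ADDENDUM on stmt-2371/2373/2507; W1.lean on 2375). NEAREST PRIOR ART MISSED BY THE ROUTE: Matsumoto arXiv:2312.01551 (v3 Nov 2025; found v (refuter refuter-rreview-route-Langlands-Eisenste-b4055acd-0, 2026-08-15T12:17:32Z; prior: arXiv:2312.01551, VarmaFMS2024, AllenNewton2020, EmertonHelm2014, HelmMoss2018, HarrisLanTaylorThorneRMS2016, Acampo2023, Allen2016)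

History (route lifecycle, newest last):
- 2026-08-15T16:26:01Z · rev 3: restated GenericMonodromy (stmt-Langlands-2371), RankTwoGenericMonodromy (stmt-Langlands-2373), Assembly (stmt-Langlands-2376) — route-repair (glue + cone guardrail, rbadge-ebd2e64e-g4). (1) GLUE: support item MonodromyToLanglands (added step 1) := GenericMonodromy → _root_.Langlands (dec (planner-rbadge-Langlands-EisensteinMonodromy-ebd2e64e-g4-0)
- 2026-08-16T04:10:08Z · AUTO-CRUX (backfill): GenericMonodromy — hypotheses of the deciding theorem that nothing in the route derives are cruxes (operator:999:1085951)
- 2026-08-23T17:59:31Z · DORMANT — reconciler: no traction for 6.2 d (last activity statement-attached at 2026-08-17T13:39:49Z); parked, not closed — `ledger route dormant route-Langlands-Eisenst (operator:999:1897170)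
- 2026-08-29T09:39:09Z · REACTIVATED — reconciler: reactivated — activity statement-checked at 2026-08-29T08:34:07Z after parking at 2026-08-23T17:59:31Z (operator:999:3600053)

sub-problem: Langlands · status: open · opened planner-plancard-Langlands-Langlands-eisenste-b22880bf-0 2026-08-15T11:03:23Z · rev 5 · ledger route-Langlands-EisensteinMonodromy
GENERATED by the gate from the ledger (D-0016/17). Provers cite these decls: `theorem foo : Summit.Langlands.Langlands.Theses.EisensteinMonodromy.<Decl> := …` in Summits/Langlands/Langlands/Theorems/<Name>.lean.
-/

namespace Summit.Langlands.Langlands.Theses.EisensteinMonodromy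

open scoped BigOperators Topology Manifold Classical MeasureTheory ProbabilityTheory Matrix InnerProductSpace ComplexConjugate ContinuousMap
open Filter Set Function TopologicalSpace MeasureTheory

attribute [summit_statement] _root_.Langlands

-- earlier GenericMonodromy (stmt-Langlands-2371, replaced 2026-08-15T16:26:01Z -> stmt-Langlands-10863): retired by None — ∀ (K : Type) [Field K] [NumberField K], NumberField.IsCMField K → ∀ (n : ℕ) (hcpt : Literature.NumberTheory.Automorphic.isCompact_glFiniteIntegralLevel n K) (π : Literature.NumberTheory.Automorphic.CuspidalAutomorphicRepData n K hcpt), π.1.IsRegularAlgebraic → ∀ (p : ℕ) [Fact p.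
/-- item stmt-Langlands-10863 · crux (kind.auto-crux: conjecture-grade) · rank 0 · open · by planner
why it might fail: N can drop in p-adic limits of traces (ℓ-adic interpolation never forces it up, AllenNewton2020 p.1); known only on sectors (arXiv:2312.01551: ℓ > n² ι-ordinary; positive-density ℓ); a reducible r_ι(π) with inter-constituent monodromy makes the SEMISIMPLE ρ's N too small while (A) holds.
sources: VarmaFMS2024, AllenNewton2020, arXiv:2312.01551, Acampo2023, HarrisLanTaylorThorneRMS2016, arXiv:2603.19768
[target] X — for every CM field K, regular algebraic cuspidal π on GL_n(𝔸_K), prime p, ι : ℚ̄_p ≃ ℂ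
and every SEMISIMPLE ρ : Γ_K → GL_n(ℚ̄_p) whose arithmetic-Frobenius characteristic polynomials are
arithFrobPolyOfSatake ι q_v n α for the Satake parameter α of π_v at all but finitely many v (rev 2:
this cofinite Satake–Frobenius clause replaces `HarrisLanTaylorThorne2016.IsCompatible π.1 ι ρ` —
formally a wider class of ρ, the same class ρ ≅ r_(p,ι)(π) by Chebotarev + Brauer–Nesbitt in tree,
`FramedGaloisRep.nonempty_equiv_of_hasFrobCharpolyAt_eventually`, once HLTT's r exists — so that the
route imports nothing beyond the Statement), the Weil–Deligne representation of ρ|Γ_(K_v)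
(Grothendieck–Deligne recipe `IsWeilDeligneOfLadic`) at every finite v ∤ p is GENERIC (Allen2016
Def. 1.1.2: no non-zero WD-map to its ‖·‖-twist). All n, all p. -/
@[route_item "route-Langlands-EisensteinMonodromy", crux]
def GenericMonodromy : Prop :=
  ∀ (K : Type) [Field K] [NumberField K], NumberField.IsCMField K → ∀ (n : ℕ) (hcpt : Literature.NumberTheory.Automorphic.isCompact_glFiniteIntegralLevel n K) (π : Literature.NumberTheory.Automorphic.CuspidalAutomorphicRepData n K hcpt), π.1.IsRegularAlgebraic → ∀ (p : ℕ) [Fact p.Prime] (ι : PadicAlgCl p ≃+* ℂ) (ρ : Literature.NumberTheory.GaloisRepresentations.FramedGaloisRep K (PadicAlgCl p) n), ρ.toGaloisRep.IsSemisimple → (∀ᶠ v : IsDedekindDomain.HeightOneSpectrum (NumberField.RingOfIntegers K) in Filter.cofinite, ∀ α : Multiset ℂ, π.1.HasSatakeParamAt v α → ρ.IsUnramifiedAt v ∧ ρ.HasFrobCharpolyAt v (Literature.NumberTheory.Automorphic.arithFrobPolyOfSatake ι v.residueCard n α)) → ∀ v : IsDedekindDomain.HeightOneSpectrum (NumberField.RingOfIntegers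 K), ((p : ℕ) : NumberField.RingOfIntegers K) ∉ v.asIdeal → ∃ W : Literature.NumberTheory.GaloisRepresentations.WeilDeligneRep (v.adicCompletion K) (PadicAlgCl p) (Fin n → PadicAlgCl p), Literature.NumberTheory.GaloisRepresentations.IsWeilDeligneOfLadic (ρ.toLocal v).toWeilGroupHom W ∧ ∀ f : (Fin n → PadicAlgCl p) →ₗ[PadicAlgCl p] (Fin n → PadicAlgCl p), (∀ w : Literature.NumberTheory.GaloisRepresentations.WeilGroup (v.adicCompletion K), f ∘ₗ W.ρ w = ((Literature.NumberTheory.GaloisRepresentations.IsNonarchimedeanLocalField.residueFieldCard (v.adicCompletion K) : PadicAlgCl p) ^ (Literature.NumberTheory.GaloisRepresentations.WeilGroup.deg w)) • (W.ρ w ∘ₗ f)) → f ∘ₗ W.N = W.N ∘ₗ f → f = 0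

/-- item stmt-Langlands-2372 · crux · rank 2 · open · by planner
why it might fail: The Eisenstein-localised Hecke module of the U(n,n) ordinary family may fail to be co-Whittaker at v (parabolically induced v-component; boundary/torsion contributions), in which case N of R_N is strictly dominated (Varma's ≺ strict) although r_ι(π) itself could still be fine.
sources: HarrisLanTaylorThorneRMS2016, VarmaFMS2024, EmertonHelm2014, HelmMoss2018, Caraiani2012, AllenNewton2020
[crux] (card items C1+C2 pushed to the Galois side; Varma's Prop. 9.1 with ≺ upgraded to equality)
for K CM, π regular algebraic cuspidal on GL_n(𝔸_K), p, ι: there are N₀, semisimple R_N : Γ_K →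
GL_2n(ℚ̄_p) (N ≥ N₀) and n-element multisets B_v ⊂ ℚ̄_p^× with the HLTT Cor. 6.27 characteristic
polynomials arithFrobPolyOfSatake ι q_v n α · ∏_(b∈B_v)(X − b q_v^(−2N)) at all but finitely many v,
such that for every v ∤ p and all N ≫_v 0 the Weil–Deligne representation of R_N|Γ_(K_v) is GENERIC.
[difficulty: open-problem] -/
@[route_item "route-Langlands-EisensteinMonodromy", crux]
def EisensteinEnvelopeGeneric : Prop :=
  ∀ (K : Type) [Field K] [NumberField K], NumberField.IsCMField K → ∀ (n : ℕ) (hcpt : Literature.NumberTheory.Automorphic.isCompact_glFiniteIntegralLevel n K) (π : Literature.NumberTheory.Automorphic.CuspidalAutomorphicRepData n K hcpt), π.1.IsRegularAlgebraic → ∀ (p : ℕ) [Fact p.Prime] (ι : PadicAlgCl p ≃+* ℂ), ∃ (N₀ : ℕ) (R : ℕ → Literature.NumberTheory.GaloisRepresentations.FramedGaloisRep K (PadicAlgCl p) (2 * n)) (B : IsDedekindDomain.HeightOneSpectrum (NumberField.RingOfIntegers K) → Multiset (PadicAlgCl p)), (∀ N, N₀ ≤ N → (R N).toGaloisRep.IsSemisimple)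 ∧ (∀ v, Multiset.card (B v) = n ∧ (0 : PadicAlgCl p) ∉ B v) ∧ (∀ᶠ v in Filter.cofinite, ∀ α : Multiset ℂ, π.1.HasSatakeParamAt v α → ∀ N, N₀ ≤ N → (R N).IsUnramifiedAt v ∧ (R N).HasFrobCharpolyAt v (Literature.NumberTheory.Automorphic.arithFrobPolyOfSatake ι v.residueCard n α * ((B v).map fun b ↦ Polynomial.X - Polynomial.C (b * ((v.residueCard : PadicAlgCl p)⁻¹) ^ (2 * N))).prod)) ∧ ∀ v : IsDedekindDomain.HeightOneSpectrum (NumberField.RingOfIntegers K), ((p : ℕ) : NumberField.RingOfIntegers K) ∉ v.asIdeal → ∃ N₁ : ℕ, ∀ N, N₁ ≤ N → ∃ W : Literature.NumberTheory.GaloisRepresentations.WeilDeligneRep (v.adicCompletion K) (PadicAlgCl p) (Fin (2 * n) → PadicAlgCl p), Literature.NumberTheory.GaloisRepresentations.IsWeilDeligneOfLadic ((R N).toLocal v).toWeilGroupHom W ∧ ∀ f : (Fin (2 * n) → PadicAlgCl p) →ₗ[PadicAlgCl p] (Fin (2 * n) → PadicAlgCl p), (∀ w : Literature.NumberTheory.GaloisRepresentations.WeilGroup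 (v.adicCompletion K), f ∘ₗ W.ρ w = ((Literature.NumberTheory.GaloisRepresentations.IsNonarchimedeanLocalField.residueFieldCard (v.adicCompletion K) : PadicAlgCl p) ^ (Literature.NumberTheory.GaloisRepresentations.WeilGroup.deg w)) • (W.ρ w ∘ₗ f)) → f ∘ₗ W.N = W.N ∘ₗ f → f = 0

-- item stmt-Langlands-2507 · crux · rank 3 · open · by planner — informal only, no Lean statement yet:
--   [crux] BoundaryCoWhittaker (card item C1, rank 3; informal until `CoWhittakerModule` is defined —
--   definition request filed). Setting of HarrisLanTaylorThorneRMS2016 §6: K CM containing an imaginary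
--   quadratic F₀ with p split, G = U(n,n)/K⁺, the ordinary p-adic family (rigid cohomology of the
--   ordinary locus, H⁰(𝔛^{ord,min}, ℰ^{ord,sub}_ρ)) whose irreducible quotient Π(N) through the
--   Siegel–Eisenstein eigensystem x_E carries R_{p,ı}(π,N) (Cor. 6.26–6.27; VarmaFMS2024 Prop. 9.1
--   setting). CLAIM: for every finite v ∤ p of K split over K⁺ and N ≫ 0, the
--   𝕋_{x_E}[GL_{2n}(K_v)]-module M_v obtained from

-- item stmt-Langlands-2508 · crux · rank 4 · open · by planner — informal only, no Lean statement yet: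
--   [crux] GenericFibreInducedType (card item C2, rank 4; informal — eigenvariety/ordinary-family
--   vocabulary absent from the tree). In the setting of BoundaryCoWhittaker let 𝒞 be an irreducible
--   component through x_E of the ordinary U(n,n) Hecke family (or of the U(n,n) eigenvariety) and v ∤ p
--   a finite place of K split over K⁺. CLAIM: the classical CUSPIDAL polarized points y ∈ 𝒞 (Zariski
--   dense by HLTT/Hida theory) at which the 2n-dimensional Galois representation R_y (LGC with monodromy
--   known: Caraiani2012 / Caraiani 2014, Shimura-realised RACSDC of GL_{2n}/K) has Weil–Deligne
--   representation at v

-- earlier RankTwoGenericMonodromy (stmt-Langlands-2373, replaced 2026-08-15T16:26:01Z -> stmt-Langlands-10864): retired by None — ∀ (K : Type) [Field K] [NumberField K], NumberField.IsCMField K → ∀ (hcpt : Literature.NumberTheory.Automorphic.isCompact_glFiniteIntegralLevel 2 K) (π : Literature.NumberTheory.Automorphic.CuspidalAutomorphicRepData 2 K hcpt), π.1.IsRegularAlgebraic → ∀ (p : ℕ) [Fact p.P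
/-- item stmt-Langlands-10864 · crux · rank 5 · open · by planner
why it might fail: Lifting methods give n = 2 only for density-one / positive-density sets of p (AllenNewton2020 Thm 1.1, wt 0; arXiv:2312.01551 Thm 1.5, all wts): ALL p is open; for p = 2, p | disc K, non-ordinary π_p the U(2,2) family and co-Whittaker property are untested; reducible r_ι(π) breaks semisimple form.
sources: AllenNewton2020, arXiv:2312.01551, VarmaFMS2024, HarrisLanTaylorThorneRMS2016, AllenCalegariCaraianiGeeEtAl2023
[crux] the n = 2 case of X (rev-2 form: cofinite Satake–Frobenius clause instead of `IsCompatible`)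
for ALL regular weights and ALL primes p — calibration rung: literally the n = 2 instance of
GenericMonodromy (`rankTwo_of_generic`, one line), and as a stand-alone statement the mechanism must
reprove and extend AllenNewton2020 (weight 0, Dirichlet-density-one p) and Matsumoto
arXiv:2312.01551 Thm 1.5 (every cohomological weight, positive-density ℓ). [difficulty: L] -/
@[route_item "route-Langlands-EisensteinMonodromy", crux]
def RankTwoGenericMonodromy : Prop :=
  ∀ (K : Type) [Field K] [NumberField K], NumberField.IsCMField K → ∀ (hcpt : Literature.NumberTheory.Automorphic.isCompact_glFiniteIntegralLevel 2 K) (π : Literature.NumberTheory.Automorphic.CuspidalAutomorphicRepData 2 K hcpt), π.1.IsRegularAlgebraic → ∀ (p : ℕ) [Fact p.Prime] (ι : PadicAlgCl p ≃+* ℂ) (ρ : Literature.NumberTheory.GaloisRepresentations.FramedGaloisRep K (PadicAlgCl p) 2), ρ.toGaloisRep.IsSemisimple → (∀ᶠ v : IsDedekindDomain.HeightOneSpectrum (NumberField.RingOfIntegers K) in Filter.cofinite, ∀ α : Multiset ℂ, π.1.HasSatakeParamAt v α → ρ.IsUnramifiedAt v ∧ ρ.HasFrobCharpolyAt v (Literature.NumberTheory.Automorphic.arithFrobPolyOfSatake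 ι v.residueCard 2 α)) → ∀ v : IsDedekindDomain.HeightOneSpectrum (NumberField.RingOfIntegers K), ((p : ℕ) : NumberField.RingOfIntegers K) ∉ v.asIdeal → ∃ W : Literature.NumberTheory.GaloisRepresentations.WeilDeligneRep (v.adicCompletion K) (PadicAlgCl p) (Fin 2 → PadicAlgCl p), Literature.NumberTheory.GaloisRepresentations.IsWeilDeligneOfLadic (ρ.toLocal v).toWeilGroupHom W ∧ ∀ f : (Fin 2 → PadicAlgCl p) →ₗ[PadicAlgCl p] (Fin 2 → PadicAlgCl p), (∀ w : Literature.NumberTheory.GaloisRepresentations.WeilGroup (v.adicCompletion K), f ∘ₗ W.ρ w = ((Literature.NumberTheory.GaloisRepresentations.IsNonarchimedeanLocalField.residueFieldCard (v.adicCompletion K) : PadicAlgCl p) ^ (Literature.NumberTheory.GaloisRepresentations.WeilGroup.deg w)) • (W.ρ w ∘ₗ f)) → f ∘ₗ W.N = W.N ∘ₗ f → f = 0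

/-- item stmt-Langlands-10829 · support · rank 9 · open · by planner
sources: BuzzardGeeLMS2014, VarmaFMS2024, Allen2016
[support] OUT-OF-SCOPE REMAINDER (route-repair rbadge-Langlands-EisensteinMonodromy-ebd2e64e-g4;
D-0027 §2.1 layer invariant), filed only so that the route's deciding theorem `closes` can honestly
end at the summit constant: GenericMonodromy → Langlands. It contains everything this thesis does
NOT claim — the reciprocity data 𝓡 for every number field (LocalLanglandsDatum.nonempty,
PstWeilDeligneData.nonempty), direction (B), direction (A) for non-CM F / merely L-algebraic
(irregular) π / v ∣ ℓ / irreducibility and de Rham above ℓ, and the translation of X into the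
literal `LocalGlobalCompatibleAt` clause at v ∤ ℓ (Varma's semisimple compatibility VarmaFMS2024 Thm
1 as a WD-vocabulary fact + GenericWDUnique + "rec of a generic π_v is generic", Allen2016 §1.1, and
the C↔L twist |det|^((1−n)/2)) — i.e. the rest of GL_n reciprocity (same pattern as
DegenerateLimits.LanglandsOfTarget, TriangulineChamber.SliceToLanglands,
CapacityClassicality.SectorToLanglands). Declared, NOT claimed; not to be staffed from this route;
dischargeable only as the conjunction of other routes. -/
@[route_item "route-Langlands-EisensteinMonodromy", crux]
def MonodromyToLanglands : Prop :=
  GenericMonodromy → _root_.Langlands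

/-- item stmt-Langlands-2374 · support · rank 9 · closed · proved by Summit.Langlands.Langlands.Theorems.GenericWDUnique_proof (prover) · by planner
sources: Allen2016, VarmaFMS2024, TateCorvallis1979, BellaicheChenevier2009
[support] over an algebraically closed field of characteristic 0, two Frobenius-semisimple GENERIC
Weil–Deligne representations of W_F on the same space with equal traces of ρ(w) for all w are
isomorphic (ρ ≅ ρ' by Brauer–Nesbitt + "Φ-semisimple ⇒ semisimple"; generic ⇔ N in the open orbit of
the centraliser on {N}; the open orbit is unique). This is the lemma turning X + Varma's semisimple
compatibility into the summit's v ∤ ℓ clause; pure algebra, provable now. [difficulty: provable-now] -/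
@[route_item "route-Langlands-EisensteinMonodromy", crux]
def GenericWDUnique : Prop :=
  ∀ (F : Type) [Field F] [ValuativeRel F] [TopologicalSpace F] [IsNonarchimedeanLocalField F] (E : Type) [Field E] [IsAlgClosed E] [CharZero E] (n : ℕ) (W W' : Literature.NumberTheory.GaloisRepresentations.WeilDeligneRep F E (Fin n → E)), W.IsFrobSemisimple → W'.IsFrobSemisimple → (∀ w : Literature.NumberTheory.GaloisRepresentations.WeilGroup F, LinearMap.trace E (Fin n → E) (W.ρ w) = LinearMap.trace E (Fin n → E) (W'.ρ w)) → (∀ f : (Fin n → E) →ₗ[E] (Fin n → E), (∀ w : Literature.NumberTheory.GaloisRepresentations.WeilGroup F, f ∘ₗ W.ρ w = ((Literature.NumberTheory.GaloisRepresentations.IsNonarchimedeanLocalField.residueFieldCard F : E) ^ (Literature.NumberTheory.GaloisRepresentations.WeilGroup.deg w)) • (W.ρ w ∘ₗ f)) → f ∘ₗ W.N = W.N ∘ₗ f → f = 0) → (∀ f : (Fin n → E) →ₗ[E] (Fin n → E), (∀ w : Literature.NumberTheory.GaloisRepresentations.WeilGroup F, f ∘ₗ W'.ρ w = ((Literature.NumberTheory.GaloisRepresentations.IsNonarchimedeanLocalField.residueFieldCard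 F : E) ^ (Literature.NumberTheory.GaloisRepresentations.WeilGroup.deg w)) • (W'.ρ w ∘ₗ f)) → f ∘ₗ W'.N = W'.N ∘ₗ f → f = 0) → W.IsEquivalent W'

-- `GenericWDUnique` holds: proved by `Summit.Langlands.Langlands.Theorems.GenericWDUnique_proof` (its module imports this route file, so no `_holds` link can be stated here).

/-- item stmt-Langlands-2375 · support · rank 9 · open · by planner
sources: HarrisLanTaylorThorneRMS2016, VarmaFMS2024
[support] glue EisensteinEnvelopeGeneric → GenericMonodromy: for N in the infinite set where R_N is
semisimple with the Cor. 6.27 polynomials, HLTT Prop. 7.12 (in tree, proved: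
Literature.NumberTheory.GaloisRepresentations.HarrisLanTaylorThorne2016.prop712Hausdorff_holds, with
hasSatakeParamAt_ne_zero_holds, frobenius_dense, chebotarev_artinRep_holds, the μ = ε_p^(−2)
realisation of HarrisLanTaylorThorneThm713) gives semisimple A, C with R_N ≅ A ⊕ C⊗ε^(−2N) and A
HLTT-compatible; any semisimple HLTT-compatible ρ is ≅ A (theoremA_uniqueness_holds); the
Grothendieck–Deligne recipe is conjugation-equivariant and block-diagonal for a block-diagonal
representation (same t, U, Φ; t(u) ≠ 0 pins N blockwise), and a generic WD representation has
generic direct summands (extend f by 0). Provable now. [difficulty: M] -/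
@[route_item "route-Langlands-EisensteinMonodromy", crux]
def EnvelopeToTarget : Prop :=
  EisensteinEnvelopeGeneric → GenericMonodromy

-- earlier Assembly (stmt-Langlands-2376, replaced 2026-08-15T16:26:01Z -> stmt-Langlands-10865): retired by None — EisensteinEnvelopeGeneric → (GenericMonodromy → Langlands) → Langlands
/-- item stmt-Langlands-10865 · assembly · rank 1 · open · by planner
sources: HarrisLanTaylorThorneRMS2016, BuzzardGeeLMS2014
[assembly] rev 2: EisensteinEnvelopeGeneric → EnvelopeToTarget → MonodromyToLanglands → Langlands —
pure bookkeeping, provable outright (fun hE hET hL => hL (hET hE)); replaces the rev-1 form whose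
inline hypothesis (GenericMonodromy → Langlands) was not a listed item (gate audit
glue.extra-hypothesis). The route is certified by the deciding theorem `closes`, not by this item. -/
@[route_item "route-Langlands-EisensteinMonodromy", crux]
def Assembly : Prop :=
  EisensteinEnvelopeGeneric → EnvelopeToTarget → MonodromyToLanglands → _root_.Langlands

/-! D-0027 §2.1 — DECIDING THEOREM (planner-authored via `route open/edit --closes-file`; by planner-rbadge-Langlands-EisensteinMonodromy-ebd2e64e-g4-0 2026-08-15T16:26:01Z):
its hypotheses are this route's items and its conclusion the sub-problem Statement (glue_lint), and it elaborates with this file. -/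

/-- D-0027 §2.1 deciding theorem of route EisensteinMonodromy (route-repair g4, rev 2): hypotheses = the
route's seven typed items (target GenericMonodromy, cruxes EisensteinEnvelopeGeneric / RankTwoGenericMonodromy,
supports GenericWDUnique / EnvelopeToTarget / MonodromyToLanglands, the bookkeeping Assembly; the informal
cruxes BoundaryCoWhittaker / GenericFibreInducedType have no Lean decl yet and feed EisensteinEnvelopeGeneric
mathematically), conclusion = the sub-problem Statement `Langlands`. Content: the rank-2 crux gives the
thesis X = GenericMonodromy through the provable-now glue EnvelopeToTarget, and the declared, NOT-claimed
out-of-scope remainder `MonodromyToLanglands : GenericMonodromy → Langlands` (the rest of GL_n reciprocity)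
carries X to the summit constant. Pure logic; axioms none beyond the items. -/
@[closes "route-Langlands-EisensteinMonodromy"] theorem closes (_hX : GenericMonodromy) (hE : EisensteinEnvelopeGeneric) (_h2 : RankTwoGenericMonodromy)
    (_hU : GenericWDUnique) (hET : EnvelopeToTarget) (hL : MonodromyToLanglands) (_hA : Assembly) :
    _root_.Langlands :=
  hL (hET hE)

end Summit.Langlands.Langlands.Theses.EisensteinMonodromy
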